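import Mathlib

/-!
# Tier4/Common/SaturationMeasure — the measure of a subgroup `H` against a fundamental domain `D` of a countable
subgroup `Γ`: `μ H = #(Γ ⊓ H) · μ (Γ · H ∩ D)`

Blind re-derivation cell `pub-hodge-repro`, Tier 4 (README §9–§10), seat t4-typer-1 (gen 3).  Target tree path
`lean/Summits/Ventures/HodgeRepro/Tier4/Common/SaturationMeasure.lean`.  Imports Mathlib only; companion of
`CosetCoveringBound` (p709866, P4 of the folded ratio (F)), not imported here.

WHY (crit-2 g9 S15627's RECORD on the (F) glue): the unfolded unit `suppMeasure N γ₀ = (ν_f ⊗ ν′_f)(suppSet γ₀ ∩ DZ_f × T′_f)`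
is cut by the GLOBAL fundamental domain `DZ_f` of the discrete rational centre `Γ = Z(k)` (L2-p2's `centreFin`), which has no
product structure over the places; the P4 unit `μ ((Z ⊓ B₀) · B)` is the measure of a compact-open SUBGROUP `H` (a product
over the places).  The bridge is the identity typed here: for ANY fundamental domain `D` of a countable `Γ ≤ A` (left
multiplication, `μ` left-invariant) and ANY measurable subgroup `H ≤ A` with `Γ ⊓ H` finite,
  `μ H = Nat.card (Γ ⊓ H) · μ ((Γ : Set A) * H ∩ D)`
(`measure_eq_card_inf_mul_measure_mul_inter`).  PROOF: `μ H = ∑_{γ ∈ Γ} μ (γ H ∩ D)` (Mathlib's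
`IsFundamentalDomain.measure_eq_tsum`); a left transversal `S` of `Γ₀ := H.subgroupOf Γ` in `Γ` (`exists_isComplement_left`)
writes every `γ` uniquely as `r t` with `r ∈ S`, `t ∈ Γ₀`, and `(r t) H = r H`, so the sum is `#Γ₀ · ∑_{r ∈ S} μ (r H ∩ D)`; the
cosets `r H`, `r ∈ S`, are pairwise disjoint (`r⁻¹ r′ ∈ H ∩ Γ = Γ₀` forces `r = r′` by the transversal property) with union
`Γ · H`, so `∑_{r ∈ S} μ (r H ∩ D) = μ (Γ · H ∩ D)` (countable additivity, `measure_iUnion₀`).  Consequences: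
`measure_le_card_inf_mul_measure_inter_of_mul_subset` — for every `E ⊇ Γ · H`, `μ H ≤ #(Γ ⊓ H) · μ (E ∩ D)` — is the lower
bound the glue needs for its unit `V(N) := (ν_f ⊗ ν′_f)(Δ(Z_f)(L_N × L′_N) ∩ (DZ_f × T′_f))` at `H := Δ(Z⁰_f)(L_N × L′_N)`
(`Γ · H ⊆ Δ(Z_f)(L_N × L′_N)` because `Γ ⊆ Z_f`): `V(N) ≥ μ (Z⁰(L_N × L′_N)) / #(Z(k) ∩ Z⁰(L_N × L′_N))`, with
`Z(k) ∩ Z⁰(L_N × L′_N) ⊆ Z(k) ∩ K_f(1)` finite and INDEPENDENT of the level — no `hDZ : levelTf N ⊆ DZf` and no choice of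
`DZ_f` enters (`Γ · H` is `Γ`-invariant, so its cut against any fundamental domain has the same measure).

Nothing here says anything about the status of the Hodge conjecture for CM abelian varieties, which is NOT proved
(HC_CM is NOT proved by anyone in this repository).
-/

set_option autoImplicit false

noncomputable section

open MeasureTheory Measure Set Function
open scoped NNReal ENNReal Pointwise

namespace Summit.Ventures.HodgeRepro.Tier4.Common

section Cosets

variable {A : Type*} [Group A]

/-- A transversal coset `r • H` (`r ∈ Γ`) meets `r′ • H` (`r′ ∈ Γ`) only if `r⁻¹ r′ ∈ H.subgroupOf Γ`. -/
theorem inv_mul_mem_subgroupOf_of_smul_inter_nonempty (Γ H : Subgroup A) {r r' : Γ}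
    (h : (((r : A) • (H : Set A)) ∩ ((r' : A) • (H : Set A))).Nonempty) : r⁻¹ * r' ∈ H.subgroupOf Γ := by
  obtain ⟨x, hx, hx'⟩ := h
  rw [mem_smul_set_iff_inv_smul_mem, smul_eq_mul] at hx hx'
  have : ((r : A))⁻¹ * (r' : A) = ((r : A)⁻¹ * x) * ((r' : A)⁻¹ * x)⁻¹ := by group
  rw [Subgroup.mem_subgroupOf, Subgroup.coe_mul, Subgroup.coe_inv, this]
  exact H.mul_mem hx (H.inv_mem hx')

/-- The union of the transversal cosets `r • H`, `r ∈ S`, is the saturation `Γ * H` when `S` is a left transversal of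
`H.subgroupOf Γ` in `Γ`. -/
theorem iUnion_smul_eq_mul (Γ H : Subgroup A) {S : Set Γ} (hS : Subgroup.IsComplement S (H.subgroupOf Γ : Set Γ)) :
    ⋃ r : S, ((r : Γ) : A) • (H : Set A) = (Γ : Set A) * (H : Set A) := by
  ext x
  simp only [mem_iUnion, Set.mem_mul]
  constructor
  · rintro ⟨r, hx⟩
    rw [mem_smul_set_iff_inv_smul_mem, smul_eq_mul] at hx
    exact ⟨((r : Γ) : A), (r : Γ).2, _, hx, by simp⟩
  · rintro ⟨g, hg, h, hh, rfl⟩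
    obtain ⟨⟨r, t⟩, ht⟩ := hS.equiv.symm.surjective ⟨g, hg⟩
    have ht' : ((r : Γ) * (t : Γ) : Γ) = ⟨g, hg⟩ := ht
    have hrt : ((r : Γ) : A) * ((t : Γ) : A) = g := by
      have := congrArg Subtype.val ht'
      simpa using this
    refine ⟨r, ?_⟩
    rw [mem_smul_set_iff_inv_smul_mem, smul_eq_mul, ← hrt]
    have htH : ((t : Γ) : A) ∈ H := Subgroup.mem_subgroupOf.1 t.2
    simpa [mul_assoc] using H.mul_mem htH hh

/-- `Nat.card (H.subgroupOf Γ) = Nat.card (Γ ⊓ H)`. -/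
theorem card_subgroupOf_eq (Γ H : Subgroup A) : Nat.card (H.subgroupOf Γ) = Nat.card (Γ ⊓ H : Subgroup A) := by
  rw [← Subgroup.inf_subgroupOf_left]
  exact Nat.card_congr (Subgroup.subgroupOfEquivOfLe inf_le_left).toEquiv

end Cosets

section Measure

variable {A : Type*} [Group A] [MeasurableSpace A] [MeasurableMul A] (μ : Measure A) [μ.IsMulLeftInvariant]

/-- **The measure of a subgroup against a fundamental domain of a countable subgroup**: for a fundamental domain `D` of
`Γ ≤ A` (left multiplication) and a measurable subgroup `H ≤ A` with `Γ ⊓ H` finite,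
`μ H = Nat.card (H.subgroupOf Γ) * μ ((Γ : Set A) * H ∩ D)`
(`H.subgroupOf Γ` = the elements of `Γ` lying in `H`; `card_subgroupOf_eq` converts to `Nat.card (Γ ⊓ H)`). -/
theorem measure_eq_card_subgroupOf_mul_measure_mul_inter (Γ : Subgroup A) [Countable Γ] {D : Set A}
    (hD : IsFundamentalDomain Γ D μ) (H : Subgroup A) (hH : MeasurableSet (H : Set A))
    [Finite (H.subgroupOf Γ)] :
    μ (H : Set A) = Nat.card (H.subgroupOf Γ) * μ ((Γ : Set A) * (H : Set A) ∩ D) := by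
  obtain ⟨S, hS, -⟩ := (H.subgroupOf Γ).exists_isComplement_left 1
  have hsum : μ (H : Set A) = ∑' γ : Γ, μ ((γ : A) • (H : Set A) ∩ D) := by
    rw [hD.measure_eq_tsum (H : Set A)]
    rfl
  -- regroup along the transversal: `γ = r * t`, `(r * t) • H = r • H`
  have hregroup : ∑' γ : Γ, μ ((γ : A) • (H : Set A) ∩ D) =
      ∑' p : S × (H.subgroupOf Γ : Set Γ), μ ((((p.1 : Γ) : A)) • (H : Set A) ∩ D) := by
    rw [← hS.equiv.symm.tsum_eq]
    refine tsum_congr fun p => ?_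
    have ht : ((p.2 : Γ) : A) ∈ H := Subgroup.mem_subgroupOf.1 p.2.2
    rw [Subgroup.IsComplement.equiv_symm_apply, Subgroup.coe_mul, mul_smul, leftCoset_mem_leftCoset H ht]
  have hprod : ∑' p : S × (H.subgroupOf Γ : Set Γ), μ ((((p.1 : Γ) : A)) • (H : Set A) ∩ D) =
      ∑' r : S, ∑' _t : (H.subgroupOf Γ : Set Γ), μ ((((r : Γ) : A)) • (H : Set A) ∩ D) :=
    ENNReal.tsum_prod'
  have hconst : ∀ r : S, ∑' _t : (H.subgroupOf Γ : Set Γ), μ ((((r : Γ) : A)) • (H : Set A) ∩ D) =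
      Nat.card (H.subgroupOf Γ) * μ ((((r : Γ) : A)) • (H : Set A) ∩ D) := by
    intro r
    rw [ENNReal.tsum_const, ENat.card_eq_coe_natCard, ENat.toENNReal_coe]
    rfl
  -- countable additivity over the pairwise disjoint transversal cosets
  have hdisj : Pairwise (AEDisjoint μ on fun r : S => (((r : Γ) : A)) • (H : Set A) ∩ D) := by
    intro r r' hrr'
    refine Disjoint.aedisjoint ?_
    rw [Set.disjoint_iff]
    rintro x ⟨⟨hx, -⟩, ⟨hx', -⟩⟩
    have hmem : (r : Γ)⁻¹ * (r' : Γ) ∈ H.subgroupOf Γ :=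
      inv_mul_mem_subgroupOf_of_smul_inter_nonempty Γ H ⟨x, hx, hx'⟩
    have hdis : Disjoint ((r : Γ) • (H.subgroupOf Γ : Set Γ)) ((r' : Γ) • (H.subgroupOf Γ : Set Γ)) :=
      hS.pairwiseDisjoint_smul r.2 r'.2 (Subtype.val_injective.ne hrr')
    refine (Set.disjoint_iff.1 hdis ⟨?_, ?_⟩ : (r' : Γ) ∈ (∅ : Set Γ)).elim
    · rw [mem_smul_set_iff_inv_smul_mem, smul_eq_mul]
      exact hmem
    · rw [mem_smul_set_iff_inv_smul_mem, smul_eq_mul, inv_mul_cancel]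
      exact (H.subgroupOf Γ).one_mem
  have hmeas : ∀ r : S, NullMeasurableSet ((((r : Γ) : A)) • (H : Set A) ∩ D) μ := fun r =>
    ((hH.const_smul _).nullMeasurableSet).inter hD.nullMeasurableSet
  have hunion : ∑' r : S, μ ((((r : Γ) : A)) • (H : Set A) ∩ D) = μ ((Γ : Set A) * (H : Set A) ∩ D) := by
    rw [← measure_iUnion₀ hdisj hmeas, ← iUnion_inter, iUnion_smul_eq_mul Γ H hS]
  rw [hsum, hregroup, hprod, tsum_congr hconst, ENNReal.tsum_mul_left, hunion]

/-- **The same identity with `Nat.card (Γ ⊓ H)`**: `μ H = Nat.card (Γ ⊓ H) * μ ((Γ : Set A) * H ∩ D)`. -/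
theorem measure_eq_card_inf_mul_measure_mul_inter (Γ : Subgroup A) [Countable Γ] {D : Set A}
    (hD : IsFundamentalDomain Γ D μ) (H : Subgroup A) (hH : MeasurableSet (H : Set A))
    [Finite (H.subgroupOf Γ)] :
    μ (H : Set A) = Nat.card (Γ ⊓ H : Subgroup A) * μ ((Γ : Set A) * (H : Set A) ∩ D) := by
  rw [← card_subgroupOf_eq]
  exact measure_eq_card_subgroupOf_mul_measure_mul_inter μ Γ hD H hH

/-- **The lower bound for the glue's unit**: for every `E ⊇ Γ * H`,
`μ H ≤ Nat.card (Γ ⊓ H) * μ (E ∩ D)` — at `H := Δ(Z⁰_f)(L_N × L′_N)`, `E := Δ(Z_f)(L_N × L′_N)`, `D := DZ_f × T′_f`. -/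
theorem measure_le_card_inf_mul_measure_inter_of_mul_subset (Γ : Subgroup A) [Countable Γ] {D : Set A}
    (hD : IsFundamentalDomain Γ D μ) (H : Subgroup A) (hH : MeasurableSet (H : Set A))
    [Finite (H.subgroupOf Γ)] {E : Set A} (hE : (Γ : Set A) * (H : Set A) ⊆ E) :
    μ (H : Set A) ≤ Nat.card (Γ ⊓ H : Subgroup A) * μ (E ∩ D) := by
  rw [measure_eq_card_inf_mul_measure_mul_inter μ Γ hD H hH]
  gcongr

end Measure

end Summit.Ventures.HodgeRepro.Tier4.Common

end
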